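import Summits.Ventures.PackingBounds.ThreePointCert.T17d11Proof
import Summits.Ventures.PackingBounds.SphericalCodes.TammesReading
import Summits.Ventures.PackingBounds.Configurations.TammesConfigsA

/-!
# Tammes problem, `N = 17`: `θ(17) < arccos(3101/5000) = 51.669…°` (kernel-checked three-point bound)

Framing: lottery ticket; floor = certified bounds/negative ranges. Venture `PackingBounds`
(cell `pub-packcert`), spherical-codes family, table B2b (Tammes) row `N = 17`.

The kernel-checked Bachoc–Vallentin three-point certificate
`ThreePointCert.T17d11.tammes17_card_le_16_sdp` (`n = 3`, `s = 3101/5000`, degree 11, Bachoc–Vallentin's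
multiplier set, Chebyshev kernels on `S²`; exact bound value `16.964445 < 17`) says: every finite set of
unit vectors of `ℝ³` with pairwise inner products `≤ 3101/5000` has at most `16` elements. In Tammes form:
among any `17` or more points of `S²` two distinct ones make an angle `< arccos(3101/5000) = 51.669…°`,
so `θ(17) < arccos(3101/5000)`. Print record: Bachoc–Vallentin, ISIT 2007, Table 5.3 (degree 10):
`θ(17) ≤ 51.69°`; best configuration known `51.0903…°` (`Config.TammesConfigsA`). A certified bound,
not a configuration and not an optimality claim.

## References
* C. Bachoc, F. Vallentin, J. Amer. Math. Soc. 21 (2008), Theorem 4.2. [`BachocVallentin2007`]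
* C. Bachoc, F. Vallentin, Semidefinite programming, multivariate orthogonal polynomials, and codes in
  spherical caps, Proc. ISIT 2007, Table 5.3.
-/

noncomputable section

open Finset
open scoped RealInnerProductSpace

namespace Summit.Ventures.PackingBounds.SphericalCodes

/-- **Tammes `N = 17`, inner products**: among any `17` or more unit vectors of `ℝ³`, two distinct ones
have inner product `> 3101/5000`. -/
theorem tammes17_exists_inner_gt (C : Finset (EuclideanSpace ℝ (Fin 3)))
    (h1 : ∀ x ∈ C, ‖x‖ = 1) (hC : 16 < C.card) :
    ∃ x ∈ C, ∃ y ∈ C, x ≠ y ∧ (3101 / 5000 : ℝ) < inner ℝ x y :=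
  exists_inner_gt_of_codeBound ThreePointCert.T17d11.tammes17_card_le_16_sdp C h1 hC

/-- **Tammes `N = 17`, angles**: among any `17` or more unit vectors of `ℝ³`, two distinct ones make an
(unoriented) angle `< arccos(3101/5000)` (`= 51.669…°`; Bachoc–Vallentin ISIT 2007 printed `51.69°`). -/
theorem tammes17_exists_angle_lt_arccos (C : Finset (EuclideanSpace ℝ (Fin 3)))
    (h1 : ∀ x ∈ C, ‖x‖ = 1) (hC : 16 < C.card) :
    ∃ x ∈ C, ∃ y ∈ C, x ≠ y ∧ InnerProductGeometry.angle x y < Real.arccos (3101 / 5000) :=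
  exists_angle_lt_arccos_of_codeBound ThreePointCert.T17d11.tammes17_card_le_16_sdp
    (by norm_num) C h1 hC

/-- **`θ(17) < arccos(3101/5000)`**: any common lower bound `θ` for the pairwise angles of `17` or more
unit vectors of `ℝ³` satisfies `θ < arccos(3101/5000)`. -/
theorem tammes17_minAngle_lt_arccos (C : Finset (EuclideanSpace ℝ (Fin 3)))
    (h1 : ∀ x ∈ C, ‖x‖ = 1) (hC : 16 < C.card) (θ : ℝ)
    (hθ : ∀ x ∈ C, ∀ y ∈ C, x ≠ y → θ ≤ InnerProductGeometry.angle x y) :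
    θ < Real.arccos (3101 / 5000) :=
  minAngle_lt_arccos_of_codeBound ThreePointCert.T17d11.tammes17_card_le_16_sdp
    (by norm_num) C h1 hC θ hθ

/-- **Kernel bracket for the 17-point Tammes problem** (both sides in the tree): there ARE 17 unit vectors of
`ℝ³` with all pairwise inner products `≤ 62809449/10⁸` (`Config.Tammes.exists_code_17`, the best
configuration known, angle `51.0903…°`), and among ANY 17 unit vectors two distinct ones have inner product
`> 3101/5000` (angle `< 51.669…°`). In Tammes terms: `51.0903…° ≤ θ(17) < 51.6693°`. -/
theorem tammes17_bracket :
    (∃ C : Finset (EuclideanSpace ℝ (Fin 3)), C.card = 17 ∧ (∀ x ∈ C, ‖x‖ = 1) ∧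
      ∀ x ∈ C, ∀ y ∈ C, x ≠ y → inner ℝ x y ≤ (62809449 : ℝ) / 100000000) ∧
    ∀ C : Finset (EuclideanSpace ℝ (Fin 3)), (∀ x ∈ C, ‖x‖ = 1) → 16 < C.card →
      ∃ x ∈ C, ∃ y ∈ C, x ≠ y ∧ (3101 / 5000 : ℝ) < inner ℝ x y :=
  ⟨Config.Tammes.exists_code_17, fun C h1 hC => tammes17_exists_inner_gt C h1 hC⟩

end Summit.Ventures.PackingBounds.SphericalCodes

end
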